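import Mathlib
import HarnessLib
import Summits.HubbardSuperconductivity.HubbardSuperconductivity.Theorems.KLProgrammeKLRegimeEngineFrameShiftMomentDoorFlowHist
import Summits.HubbardSuperconductivity.HubbardSuperconductivity.Theorems.KLProgrammeKLRegimeEngineFrameShiftScaleWindow
import Summits.HubbardSuperconductivity.HubbardSuperconductivity.Theorems.KLProgrammeKLRegimeEngineIsoTupleV17FDoor

/-!
# K3 gen-8-FLOW (stmt 20437 `KLRegimeEngineV17F2`, stub (C)): DOOR (B) AT THE ENGINE'S SCALE `Λ = Λ_n`, READ AT `±ω₀` — VOLUME-FREE, SCALE-EXPLICIT FORM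

Cell gate-hubbard-kl, seat p2 g12.  The history-keyed door (`…EngineFrameShiftMomentDoorFlowHist`, p552227) at the engine's own data: one-shot cutoff
`Λ = Λ_n = klScale klE0 n` for the two frames `K_n`, `K_{n+1}`, reading frequency `ω_i ∈ {ω₀, −ω₀}`, `β ≥ klBetaMin`, `n ≤ nScales β + 1` (so the scale window holds
with `X₁ = 384`, `…EngineFrameShiftScaleWindow`), the frame rate `frameDist K_{n+1} K_n ≤ R.Gfr 0·|U|·4^{−2n}` (`frameDist_klFlowFrameU_succ_le`, (I-F jets)).
The volume factors CANCEL (as they must: `Nₚ`, `Sₚ` are volume-normalised pinned norms):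

* **`moment_selfEnergy_flowStep_sub_le_at_scale`** —
  `Σ_x (1+|x̃₀|+|x̃₁|)ʳ ‖𝔉⁻¹[k⃗ ↦ Σ[𝒢(C^{K_{n+1}}_{>Λ_n},V_U)]((ω_i,k⃗),σ) − Σ[𝒢(C^{K_n}_{>Λ_n},V_U)](…)](x)‖
     ≤ 3072·(2B+1)·R.Gfr 0·|U|·4^{−n}·Nₚ + (56/3)·3ʳ·B·384²·T·4^{(r+2)n}·Sₚ²`,
  `T = Σ_{k ≤ r+2} (π/2)^k Σ_{j ≤ k} C(k,j)·j!²·(max d 1·384)^j·A_{k−j}` (defining equation), `d = 4 + 2ΣA`, `A` the geometric piece table;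
* **`norm_iteratedFDeriv_evalM_symInterp_flowStep_response_le_at_scale`** — the READING (momentum jets `j ≤ 4` of the interpolated `ω₀/−ω₀`, spin average of the
  real part), same right-hand side with `r := j` — the (B) input of c4a-1's (P) before the chain rule along the curve.

Proofs only; `Nₚ`, `Sₚ`, `Z_t ≠ 0` are hypotheses (registrant); nothing asserts superconductivity.  References: BGM 2006 §3 (3.2)–(3.8)
[cite: BenfattoGiulianiMastropietro2006].
-/

noncomputable section

namespace Summit.HubbardSuperconductivity.HubbardSuperconductivity.Theorems.EngineV8

set_option linter.dupNamespace false -- summit = problem name (single-conjunct summit), D-0017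

open Finset Literature.MathematicalPhysics.QuantumLattice Literature.Probability.LatticeModels GrassmannAlgebra Set
open Summit.HubbardSuperconductivity.HubbardSuperconductivity.Theorems.KLRegimeSplit
open Summit.HubbardSuperconductivity.HubbardSuperconductivity.Theorems.KLProgrammeLegKernels
open scoped Nat

variable {L M : ℕ} [NeZero L] [NeZero M]

/-- **DOOR (B) AT THE ENGINE'S SCALE, VOLUME-FREE**: for `β ≥ klBetaMin`, `n ≤ nScales β + 1`, `ω_i = ±ω₀`, `r ≤ 4`: the order-`r` position moments of the
two-leg frame response between `K_n` and `K_{n+1}` (one-shot cutoff `Λ_n`) are at most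
`3072·(2B+1)·Gfr₀·|U|·4^{−n}·Nₚ + (56/3)·3ʳ·B·384²·T·4^{(r+2)n}·Sₚ²`. -/
theorem moment_selfEnergy_flowStep_sub_le_at_scale {β : ℝ} (hβm : klBetaMin ≤ β) {μ : ℝ} (hμ : μ ∈ klWindowC) (U : ℝ) {n : ℕ}
    (hn : n ≤ nScales β + 1) {s₀ s₁ : FreqMomentum L M × Fin 2 → ℂ}
    (hs₀ : s₀ = uvSymbolCT L M β μ (klFlowFrameU L M β U μ n) (klScale klE0 n))
    (hs₁ : s₁ = uvSymbolCT L M β μ (klFlowFrameU L M β U μ (n + 1)) (klScale klE0 n)) {i : MatsubaraIdx M}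
    (hi : i = omega0 M ∨ i = (omega0 M).rev) (σ : Fin 2) {r : ℕ} (hr : r ≤ 4)
    (hZ : ∀ t ∈ Set.Icc (0 : ℝ) 1, effPartitionFn ℂ (normalCovariance L M s₀ + ((t : ℂ)) • (normalCovariance L M s₁ - normalCovariance L M s₀))
      (hubbardInteraction L M β U) ≠ 0)
    {Np Sp : ℝ}
    (hNp : ∀ t ∈ Set.Icc (0 : ℝ) 1, ∀ (τ c : Fin 2) (x₀ : SpaceTimeIdx L M), imagTimeWeight β M ^ 3 *
      ∑ x ∈ (univ : Finset (Fin 4 → SpaceTimeIdx L M)).filter (fun x => x 0 = x₀),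
        (1 + ((((x 1).2 - (x 0).2) 0).valMinAbs.natAbs : ℝ) + ((((x 1).2 - (x 0).2) 1).valMinAbs.natAbs : ℝ)) ^ r *
          ‖sectorisedKernel L M β (trivialMultiplier L M)
              (effAction ℂ (normalCovariance L M s₀ + ((t : ℂ)) • (normalCovariance L M s₁ - normalCovariance L M s₀))
                (hubbardInteraction L M β U)) 4
              (![((0, σ), 0), ((0, σ), 1), ((0, τ), 1 - c), ((0, τ), c)] : Fin 4 → SectorLeg 1) x‖ ≤ Np)
    (hSp : ∀ t ∈ Set.Icc (0 : ℝ) 1, ∀ x₀ : SpaceTimeIdx L M, imagTimeWeight β M *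
      ∑ x ∈ (univ : Finset (Fin 2 → SpaceTimeIdx L M)).filter (fun x => x 0 = x₀),
        (1 + ((((x 1).2 - (x 0).2) 0).valMinAbs.natAbs : ℝ) + ((((x 1).2 - (x 0).2) 1).valMinAbs.natAbs : ℝ)) ^ r *
          ‖sectorisedKernel L M β (trivialMultiplier L M)
              (effAction ℂ (normalCovariance L M s₀ + ((t : ℂ)) • (normalCovariance L M s₁ - normalCovariance L M s₀))
                (hubbardInteraction L M β U)) 2
              (![((0, σ), 0), ((0, σ), 1)] : Fin 2 → SectorLeg 1) x‖ ≤ Sp)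
    {N' : ℕ} {B : ℝ} (hB1 : 1 ≤ B) (hB : ∀ l ≤ N', ∀ t, ‖iteratedDeriv l salmhoferCutoff t‖ ≤ B) (hN' : r + 4 ≤ N')
    {G : GeoConsts} {Q : EngConsts} {R : RenConsts} (hGS : ∀ k, 0 ≤ G.S k) (hQS : ∀ k, 0 ≤ Q.S' k) (hRG : ∀ j, 0 ≤ R.Gfr j)
    (hP : ∀ m ≤ n, FlowPieceJetsAt L M β U μ R m) (hT : ∀ m ≤ n, TwoLegReadJetsF L M G Q β U μ m)
    {A : ℕ → ℝ} (hA : ∀ j, A j = if j ≤ 4 then R.Gfr j * uPow j U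
      else 2 ^ j * (Real.pi ^ 8 / 4 * 2 ^ (j - 1) * (2 : ℝ) ^ (8 * (j - 1))) * ((curveExtC B G.S 1 + curveExtC B Q.S' 1 * |U|) * U ^ 2))
    {d : ℝ} (hd : d = 4 + 2 * ∑ j' ∈ range (r + 3), A j')
    {T : ℝ} (hTd : T = ∑ k' ∈ Finset.range (r + 3), (Real.pi / 2) ^ k' *
      ∑ j ∈ Finset.range (k' + 1), (k'.choose j : ℝ) * ((j ! : ℝ) * j !) * (max d 1 * 384) ^ j * A (k' - j)) :
    ∑ x : TorusSite 2 L, (1 + ((x 0).valMinAbs.natAbs : ℝ) + ((x 1).valMinAbs.natAbs : ℝ)) ^ r * ‖torusFourierInv (fun kv : TorusSite 2 L =>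
        selfEnergy L M β (effAction ℂ (normalCovariance L M s₁) (hubbardInteraction L M β U)) (i, kv) σ -
          selfEnergy L M β (effAction ℂ (normalCovariance L M s₀) (hubbardInteraction L M β U)) (i, kv) σ) x‖ ≤
      3072 * (2 * B + 1) * R.Gfr 0 * |U| * ((4 : ℝ) ^ n)⁻¹ * Np + 56 / 3 * 3 ^ r * B * 384 ^ 2 * T * (4 : ℝ) ^ ((r + 2) * n) * Sp ^ 2 := by
  have hβ : 0 < β := pos_of_klBetaMin_le hβm
  have hΛ : 0 < klScale klE0 n := klth_klScale_pos n
  have hL : (0 : ℝ) < (L : ℝ) := by exact_mod_cast NeZero.pos L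
  have hwin : (4 : ℝ) ^ n ≤ 6 / max |matsubaraFreq β M i| (klScale klE0 n / 2) ∧
      6 / max |matsubaraFreq β M i| (klScale klE0 n / 2) ≤ 384 * (4 : ℝ) ^ n := by
    rcases hi with rfl | rfl
    · exact scaleWindow_omega0 hβm hn
    · exact scaleWindow_omega0_rev hβm hn
  have hdoor := moment_selfEnergy_flowStep_sub_le_of_hist hβ hΛ hμ U n hs₀ hs₁ i σ hr hZ hNp hSp hB1 hB hN' hGS hQS hRG hP hT hwin.1 hwin.2
    hA hd (J := 2 * (β * (L : ℝ) ^ 2) * B * 384 ^ 2 / 9 * T * (4 : ℝ) ^ ((r + 2) * n)) (by rw [hTd])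
  refine hdoor.trans ?_
  -- the frame rate and the sign of `Np`
  have hfd : frameDist (klFlowFrameU L M β U μ (n + 1)) (klFlowFrameU L M β U μ n) ≤ R.Gfr 0 * |U| * (((4 : ℝ) ^ n)⁻¹) ^ 2 := by
    have h := frameDist_klFlowFrameU_succ_le (L := L) (M := M) (β := β) (U := U) (μ := μ) (R := R) (j := n)
      (fun m hm => hP m (by omega))
    have hu : uPow 0 U = |U| := by simp [uPow]
    have hz : (4 : ℝ) ^ ((((0 : ℕ) : ℤ) - 2) * (n : ℤ)) = (((4 : ℝ) ^ n)⁻¹) ^ 2 := by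
      rw [show (((0 : ℕ) : ℤ) - 2) * (n : ℤ) = -((n * 2 : ℕ) : ℤ) by push_cast; ring, zpow_neg, zpow_natCast, pow_mul, inv_pow]
    rwa [hu, hz] at h
  have hNp0 : 0 ≤ Np := by
    refine le_trans ?_ (hNp 0 ⟨le_rfl, zero_le_one⟩ 0 0 (i, 0))
    exact mul_nonneg (pow_nonneg (imagTimeWeight_nonneg hβ.le M) 3)
      (sum_nonneg fun x _ => mul_nonneg (by positivity) (norm_nonneg _))
  have hB0 : 0 ≤ B := zero_le_one.trans hB1
  -- the algebra: the volume factors cancel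
  have hΛeq : klScale klE0 n = ((4 : ℝ) ^ n)⁻¹ / 32 := by
    unfold klScale klE0
    ring
  have h4 : (0 : ℝ) < (4 : ℝ) ^ n := by positivity
  have heq : 2 * (|β| * (L : ℝ) ^ 2) *
      (12 * (2 * (L : ℝ) ^ 2 * ((2 * B + 1) * (β * (L : ℝ) ^ 2)) * (2 * β / klScale klE0 n) *
          frameDist (klFlowFrameU L M β U μ (n + 1)) (klFlowFrameU L M β U μ n)) * (Np / (β * (L : ℝ) ^ 2) ^ 3) +
        2 * (21 * 3 ^ r * (2 * (β * (L : ℝ) ^ 2) * B * 384 ^ 2 / 9 * T * (4 : ℝ) ^ ((r + 2) * n))) * (Sp / (β * (L : ℝ) ^ 2)) ^ 2) =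
      96 * (2 * B + 1) * (32 * (4 : ℝ) ^ n) * frameDist (klFlowFrameU L M β U μ (n + 1)) (klFlowFrameU L M β U μ n) * Np +
        56 / 3 * 3 ^ r * B * 384 ^ 2 * T * (4 : ℝ) ^ ((r + 2) * n) * Sp ^ 2 := by
    rw [abs_of_pos hβ, hΛeq]
    field_simp
    ring
  rw [heq]
  have hloop : 96 * (2 * B + 1) * (32 * (4 : ℝ) ^ n) * frameDist (klFlowFrameU L M β U μ (n + 1)) (klFlowFrameU L M β U μ n) * Np ≤
      3072 * (2 * B + 1) * R.Gfr 0 * |U| * ((4 : ℝ) ^ n)⁻¹ * Np := by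
    have h1 : 96 * (2 * B + 1) * (32 * (4 : ℝ) ^ n) * frameDist (klFlowFrameU L M β U μ (n + 1)) (klFlowFrameU L M β U μ n) ≤
        96 * (2 * B + 1) * (32 * (4 : ℝ) ^ n) * (R.Gfr 0 * |U| * (((4 : ℝ) ^ n)⁻¹) ^ 2) :=
      mul_le_mul_of_nonneg_left hfd (by positivity)
    have h2 : 96 * (2 * B + 1) * (32 * (4 : ℝ) ^ n) * (R.Gfr 0 * |U| * (((4 : ℝ) ^ n)⁻¹) ^ 2) =
        3072 * (2 * B + 1) * R.Gfr 0 * |U| * ((4 : ℝ) ^ n)⁻¹ := by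
      field_simp
      ring
    exact (mul_le_mul_of_nonneg_right h1 hNp0).trans_eq (by rw [h2])
  linarith

/-- **DOOR (B) READ AT THE ENGINE'S SCALE, VOLUME-FREE**: for `β ≥ klBetaMin`, `n ≤ nScales β + 1`, `j ≤ 4`: the momentum jets of order `j` of the interpolated
spin/frequency average (frequencies `ω₀`, `−ω₀`) of the real part of the two-leg frame response between `K_n` and `K_{n+1}` (one-shot cutoff `Λ_n`) are at most
`3072·(2B+1)·Gfr₀·|U|·4^{−n}·Nₚ + (56/3)·3ʲ·B·384²·T·4^{(j+2)n}·Sₚ²` — the (B) input of c4a-1's (P) before the chain rule along the curve. -/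
theorem norm_iteratedFDeriv_evalM_symInterp_flowStep_response_le_at_scale {β : ℝ} (hβm : klBetaMin ≤ β) {μ : ℝ} (hμ : μ ∈ klWindowC) (U : ℝ)
    {n : ℕ} (hn : n ≤ nScales β + 1) {s₀ s₁ : FreqMomentum L M × Fin 2 → ℂ}
    (hs₀ : s₀ = uvSymbolCT L M β μ (klFlowFrameU L M β U μ n) (klScale klE0 n))
    (hs₁ : s₁ = uvSymbolCT L M β μ (klFlowFrameU L M β U μ (n + 1)) (klScale klE0 n)) {j : ℕ} (hjr : j ≤ 4)
    (hZ : ∀ t ∈ Set.Icc (0 : ℝ) 1, effPartitionFn ℂ (normalCovariance L M s₀ + ((t : ℂ)) • (normalCovariance L M s₁ - normalCovariance L M s₀))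
      (hubbardInteraction L M β U) ≠ 0)
    {Np Sp : ℝ}
    (hNp : ∀ (σ τ c : Fin 2), ∀ t ∈ Set.Icc (0 : ℝ) 1, ∀ x₀ : SpaceTimeIdx L M, imagTimeWeight β M ^ 3 *
      ∑ x ∈ (univ : Finset (Fin 4 → SpaceTimeIdx L M)).filter (fun x => x 0 = x₀),
        (1 + ((((x 1).2 - (x 0).2) 0).valMinAbs.natAbs : ℝ) + ((((x 1).2 - (x 0).2) 1).valMinAbs.natAbs : ℝ)) ^ j *
          ‖sectorisedKernel L M β (trivialMultiplier L M)
              (effAction ℂ (normalCovariance L M s₀ + ((t : ℂ)) • (normalCovariance L M s₁ - normalCovariance L M s₀))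
                (hubbardInteraction L M β U)) 4
              (![((0, σ), 0), ((0, σ), 1), ((0, τ), 1 - c), ((0, τ), c)] : Fin 4 → SectorLeg 1) x‖ ≤ Np)
    (hSp : ∀ (σ : Fin 2), ∀ t ∈ Set.Icc (0 : ℝ) 1, ∀ x₀ : SpaceTimeIdx L M, imagTimeWeight β M *
      ∑ x ∈ (univ : Finset (Fin 2 → SpaceTimeIdx L M)).filter (fun x => x 0 = x₀),
        (1 + ((((x 1).2 - (x 0).2) 0).valMinAbs.natAbs : ℝ) + ((((x 1).2 - (x 0).2) 1).valMinAbs.natAbs : ℝ)) ^ j *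
          ‖sectorisedKernel L M β (trivialMultiplier L M)
              (effAction ℂ (normalCovariance L M s₀ + ((t : ℂ)) • (normalCovariance L M s₁ - normalCovariance L M s₀))
                (hubbardInteraction L M β U)) 2
              (![((0, σ), 0), ((0, σ), 1)] : Fin 2 → SectorLeg 1) x‖ ≤ Sp)
    {N' : ℕ} {B : ℝ} (hB1 : 1 ≤ B) (hB : ∀ l ≤ N', ∀ t, ‖iteratedDeriv l salmhoferCutoff t‖ ≤ B) (hN' : j + 4 ≤ N')
    {G : GeoConsts} {Q : EngConsts} {R : RenConsts} (hGS : ∀ k, 0 ≤ G.S k) (hQS : ∀ k, 0 ≤ Q.S' k) (hRG : ∀ j, 0 ≤ R.Gfr j)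
    (hP : ∀ m ≤ n, FlowPieceJetsAt L M β U μ R m) (hT : ∀ m ≤ n, TwoLegReadJetsF L M G Q β U μ m)
    {A : ℕ → ℝ} (hA : ∀ j', A j' = if j' ≤ 4 then R.Gfr j' * uPow j' U
      else 2 ^ j' * (Real.pi ^ 8 / 4 * 2 ^ (j' - 1) * (2 : ℝ) ^ (8 * (j' - 1))) * ((curveExtC B G.S 1 + curveExtC B Q.S' 1 * |U|) * U ^ 2))
    {d : ℝ} (hd : d = 4 + 2 * ∑ j' ∈ range (j + 3), A j')
    {T : ℝ} (hTd : T = ∑ k' ∈ Finset.range (j + 3), (Real.pi / 2) ^ k' *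
      ∑ j' ∈ Finset.range (k' + 1), (k'.choose j' : ℝ) * ((j' ! : ℝ) * j' !) * (max d 1 * 384) ^ j' * A (k' - j'))
    (q : Momentum) :
    ‖iteratedFDeriv ℝ j (evalM (symInterp L (fun kv : TorusSite 2 L => (∑ σ : Fin 2,
        ((selfEnergy L M β (effAction ℂ (normalCovariance L M s₁) (hubbardInteraction L M β U)) (omega0 M, kv) σ -
            selfEnergy L M β (effAction ℂ (normalCovariance L M s₀) (hubbardInteraction L M β U)) (omega0 M, kv) σ).re +
          (selfEnergy L M β (effAction ℂ (normalCovariance L M s₁) (hubbardInteraction L M β U)) ((omega0 M).rev, kv) σ -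
            selfEnergy L M β (effAction ℂ (normalCovariance L M s₀) (hubbardInteraction L M β U)) ((omega0 M).rev, kv) σ).re)) / 4))) q‖ ≤
      3072 * (2 * B + 1) * R.Gfr 0 * |U| * ((4 : ℝ) ^ n)⁻¹ * Np + 56 / 3 * 3 ^ j * B * 384 ^ 2 * T * (4 : ℝ) ^ ((j + 2) * n) * Sp ^ 2 := by
  have hβ : 0 < β := pos_of_klBetaMin_le hβm
  have hΛ : 0 < klScale klE0 n := klth_klScale_pos n
  have hL : (0 : ℝ) < (L : ℝ) := by exact_mod_cast NeZero.pos L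
  obtain ⟨hlo, hhi⟩ := scaleWindow_of_eq_or (M := M) hβm hn
  have hdoor := norm_iteratedFDeriv_evalM_symInterp_flowStep_response_le_of_hist hβ hΛ hμ U n hs₀ hs₁ (omega0 M) (omega0 M).rev hjr hZ hNp hSp
    hB1 hB hN' hGS hQS hRG hP hT hlo hhi hA hd (J := 2 * (β * (L : ℝ) ^ 2) * B * 384 ^ 2 / 9 * T * (4 : ℝ) ^ ((j + 2) * n)) (by rw [hTd]) q
  refine hdoor.trans ?_
  have hfd : frameDist (klFlowFrameU L M β U μ (n + 1)) (klFlowFrameU L M β U μ n) ≤ R.Gfr 0 * |U| * (((4 : ℝ) ^ n)⁻¹) ^ 2 := by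
    have h := frameDist_klFlowFrameU_succ_le (L := L) (M := M) (β := β) (U := U) (μ := μ) (R := R) (j := n)
      (fun m hm => hP m (by omega))
    have hu : uPow 0 U = |U| := by simp [uPow]
    have hz : (4 : ℝ) ^ ((((0 : ℕ) : ℤ) - 2) * (n : ℤ)) = (((4 : ℝ) ^ n)⁻¹) ^ 2 := by
      rw [show (((0 : ℕ) : ℤ) - 2) * (n : ℤ) = -((n * 2 : ℕ) : ℤ) by push_cast; ring, zpow_neg, zpow_natCast, pow_mul, inv_pow]
    rwa [hu, hz] at h
  have hNp0 : 0 ≤ Np := by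
    refine le_trans ?_ (hNp 0 0 0 0 ⟨le_rfl, zero_le_one⟩ (omega0 M, 0))
    exact mul_nonneg (pow_nonneg (imagTimeWeight_nonneg hβ.le M) 3)
      (sum_nonneg fun x _ => mul_nonneg (by positivity) (norm_nonneg _))
  have hB0 : 0 ≤ B := zero_le_one.trans hB1
  have hΛeq : klScale klE0 n = ((4 : ℝ) ^ n)⁻¹ / 32 := by
    unfold klScale klE0
    ring
  have h4 : (0 : ℝ) < (4 : ℝ) ^ n := by positivity
  have heq : 2 * (|β| * (L : ℝ) ^ 2) *
      (12 * (2 * (L : ℝ) ^ 2 * ((2 * B + 1) * (β * (L : ℝ) ^ 2)) * (2 * β / klScale klE0 n) *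
          frameDist (klFlowFrameU L M β U μ (n + 1)) (klFlowFrameU L M β U μ n)) * (Np / (β * (L : ℝ) ^ 2) ^ 3) +
        2 * (21 * 3 ^ j * (2 * (β * (L : ℝ) ^ 2) * B * 384 ^ 2 / 9 * T * (4 : ℝ) ^ ((j + 2) * n))) * (Sp / (β * (L : ℝ) ^ 2)) ^ 2) =
      96 * (2 * B + 1) * (32 * (4 : ℝ) ^ n) * frameDist (klFlowFrameU L M β U μ (n + 1)) (klFlowFrameU L M β U μ n) * Np +
        56 / 3 * 3 ^ j * B * 384 ^ 2 * T * (4 : ℝ) ^ ((j + 2) * n) * Sp ^ 2 := by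
    rw [abs_of_pos hβ, hΛeq]
    field_simp
    ring
  rw [heq]
  have hloop : 96 * (2 * B + 1) * (32 * (4 : ℝ) ^ n) * frameDist (klFlowFrameU L M β U μ (n + 1)) (klFlowFrameU L M β U μ n) * Np ≤
      3072 * (2 * B + 1) * R.Gfr 0 * |U| * ((4 : ℝ) ^ n)⁻¹ * Np := by
    have h1 : 96 * (2 * B + 1) * (32 * (4 : ℝ) ^ n) * frameDist (klFlowFrameU L M β U μ (n + 1)) (klFlowFrameU L M β U μ n) ≤
        96 * (2 * B + 1) * (32 * (4 : ℝ) ^ n) * (R.Gfr 0 * |U| * (((4 : ℝ) ^ n)⁻¹) ^ 2) :=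
      mul_le_mul_of_nonneg_left hfd (by positivity)
    have h2 : 96 * (2 * B + 1) * (32 * (4 : ℝ) ^ n) * (R.Gfr 0 * |U| * (((4 : ℝ) ^ n)⁻¹) ^ 2) =
        3072 * (2 * B + 1) * R.Gfr 0 * |U| * ((4 : ℝ) ^ n)⁻¹ := by
      field_simp
      ring
    exact (mul_le_mul_of_nonneg_right h1 hNp0).trans_eq (by rw [h2])
  linarith

end Summit.HubbardSuperconductivity.HubbardSuperconductivity.Theorems.EngineV8

end
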